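import Literature.AlgebraicGeometry.Resolution.BlowupAlgebraLift
import Mathlib.RingTheory.DiscreteValuationRing.Basic
import Mathlib.RingTheory.Flat.TorsionFree
import Mathlib.RingTheory.DedekindDomain.Basic
import HarnessLib

/-!
# Dilatations (affine Néron blowups) over a discrete valuation ring: the affine case

Topic: `Literature/AlgebraicGeometry/Dilatations`. Let `O` be a discrete valuation ring with
uniformizer `ϖ`, `A` an `O`-algebra (`X = Spec A` an affine `O`-scheme) and `I ⊆ A` an ideal
containing `ϖ` (a closed subscheme `Y = V(I)` of the special fibre `X_k = V(ϖ)`). The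
**dilatation of `Y` in `X`** is the affine `X`-scheme `X' = Spec A[I/ϖ]`, where
`A[I/ϖ] ⊆ A[1/ϖ] = A ⊗_O K` is the `A`-subalgebra generated by the `y/ϖ`, `y ∈ I` — the affine
blowup algebra of `I` at `ϖ` (Mayeux–Richarz–Romagny, *Néron blowups and low-degree cohomological
applications*, §2.1: "the dilatation (or affine blowup) of `X` in `Z` along `D` is the `X`-affine
scheme `Spec` of the affine blowup algebra"; "the ring `B[I/b]` is the `B`-subalgebra of `B[b⁻¹]`
generated by fractions `x/b` with `x ∈ I`"; Bosch–Lütkebohmert–Raynaud, *Néron Models*, §3.2).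
This is the elementary operation of Néron's smoothening process (M. Artin, *Néron Models*, proof
of Lemma (3.9), step (f): "Blow up `Y` by the substitution `pz = x`"; BLR §3.4).

This file sets up the affine case on top of the tree's affine blowup algebra
(`Resolution.blowupAlgebra`, `Resolution/AffineBlowupAlgebra.lean`, with its universal property
`Resolution/BlowupAlgebraLift.lean`) and PROVES the defining properties (MRR §2.1–2.3; BLR
Prop. 3.2/1):

* `dilatation ϖ I : Subalgebra A (Localization.Away (algebraMap O A ϖ))` — the algebra `A[I/ϖ]`;
* `dilatation.isTorsionFree`, `dilatation.flat` — **`A[I/ϖ]` is flat over `O`** (it sits in the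
  `K`-algebra `A[1/ϖ]`; BLR 3.2/1: dilatations are flat `R`-schemes), with no flatness
  hypothesis on `A`;
* `dilatation.isLocalization_away` — **the generic fibre is unchanged**, `A[I/ϖ][1/ϖ] = A[1/ϖ]`
  (MRR §2.1, `B[I/b][b⁻¹] = B[b⁻¹]`);
* `dilatation.map_eq_span`, `dilatation.mem_nonZeroDivisors` — the exceptional divisor:
  `I·A[I/ϖ] = ϖ·A[I/ϖ]` with `ϖ` regular (MRR §2.2, Lemma: "`Bl ×_X Z = Bl ×_X D`, an effective
  Cartier divisor"; i.e. the special fibre of `X'` is the preimage of `Y`);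
* `dilatation.lift`, `dilatation.ringHom_ext`, `dilatation.existsUnique_lift`,
  `dilatation.map_le_span_of_comp_eq` — **the universal property** (MRR §2.3, Proposition: `X' → X`
  represents, on `X`-schemes `T` on which `T ×_X D` is an effective Cartier divisor, the functor
  "`T ×_X D → X` factors through `Z`"; BLR 3.2/1 (b)): for an `O`-algebra `C` in which `ϖ` is a
  non-zero-divisor — e.g. any flat `O`-algebra (`dilatation.existsUnique_algHom_of_flat`), such
  as a discrete valuation ring dominating `O` — the `A`-algebra homomorphisms `A[I/ϖ] → C` are in
  bijection with the ring homomorphisms `φ : A → C` with `φ(I) ⊆ ϖC`, i.e. the `C`-valued points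
  of `X'` are the `C`-valued points of `X` whose special fibre factors through `Y`.

Scheme-level dilatations of non-affine `O`-schemes (by gluing, or as an open subscheme of the
blowing up, MRR §2.2 first Lemma) are not needed here and not constructed.

## References

* A. Mayeux, T. Richarz, M. Romagny, *Néron blowups and low-degree cohomological applications*,
  arXiv:2001.03597 (2020), §2.1 (definition; `b` regular, `bB[I/b] = IB[I/b]`,
  `B[I/b][b⁻¹] = B[b⁻¹]`), §2.2 (exceptional divisor), §2.3 (universal property).
  [MayeuxRicharzRomagny2020]
* S. Bosch, W. Lütkebohmert, M. Raynaud, *Néron Models*, Springer 1990, §3.2, Prop. 3.2/1.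
  [BLRNeronModels1990] (Not held; numbers only.)
* M. Artin, *Néron Models*, in Cornell–Silverman (eds.), *Arithmetic Geometry*, Springer 1986,
  proof of Lemma (3.9), step (f) (p. 227). [Artin1986NeronModels]
* U. Görtz, T. Wedhorn, *Algebraic Geometry I*, 2nd ed. (2020), (13.19), p. 415 (the algebras
  `A[I/f]` and their universal property). [GortzWedhorn2020]
-/

noncomputable section

open IsLocalization Literature.AlgebraicGeometry.Resolution

namespace Literature.AlgebraicGeometry.Dilatations

universe u v w

section General

variable {O : Type u} [CommRing O] (ϖ : O) {A : Type v} [CommRing A] [Algebra O A] (I : Ideal A)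

/-- **The dilatation algebra `A[I/ϖ] ⊆ A[1/ϖ]`** of the ideal `I` (a closed subscheme of
`Spec A` inside the divisor `V(ϖ)` when `ϖ ∈ I`): the affine blowup algebra of `I` at (the image
of) `ϖ`, i.e. the `A`-subalgebra of `A[1/ϖ]` generated by the `y/ϖ`, `y ∈ I` (MRR §2.1;
BLR §3.2). [cite: MayeuxRicharzRomagny2020, §2.1 (Definition: affine blowup algebra and dilatation)] -/
abbrev dilatation : Subalgebra A (Localization.Away (algebraMap O A ϖ)) :=
  blowupAlgebra I (algebraMap O A ϖ)

namespace dilatation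

/-- `y/ϖ ∈ A[I/ϖ]` for `y ∈ I`. [cite: MayeuxRicharzRomagny2020, §2.1] -/
theorem div_mem {y : A} (hy : y ∈ I) :
    algebraMap A (Localization.Away (algebraMap O A ϖ)) y * Away.invSelf (algebraMap O A ϖ) ∈
      dilatation ϖ I :=
  div_mem_blowupAlgebra I _ hy

/-- **`ϖ` is a non-zero-divisor of `A[I/ϖ]`** (MRR §2.1, "the image of `b` in `B[I/b]` is a
non-zero divisor"). [cite: MayeuxRicharzRomagny2020, §2.1] -/
theorem mem_nonZeroDivisors :
    algebraMap O (dilatation ϖ I) ϖ ∈ nonZeroDivisors (dilatation ϖ I) := by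
  rw [IsScalarTower.algebraMap_apply O A (dilatation ϖ I)]
  exact algebraMap_mem_nonZeroDivisors_blowupAlgebra

/-- **The exceptional divisor: `I·A[I/ϖ] = ϖ·A[I/ϖ]`** for `ϖ ∈ I` (MRR §2.1,
"`bB[I/b] = IB[I/b]`"; §2.2, Lemma: the preimage of the centre is the preimage of the divisor,
an effective Cartier divisor — here: the special fibre of the dilatation is the preimage of
`Y = V(I)`). [cite: MayeuxRicharzRomagny2020, §2.1–2.2] -/
theorem map_eq_span (hϖ : algebraMap O A ϖ ∈ I) :
    I.map (algebraMap A (dilatation ϖ I)) = Ideal.span {algebraMap O (dilatation ϖ I) ϖ} := by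
  rw [IsScalarTower.algebraMap_apply O A (dilatation ϖ I)]
  exact map_blowupAlgebra_eq_span hϖ

/-- **The generic fibre is unchanged: `A[I/ϖ][1/ϖ] = A[1/ϖ]`** (MRR §2.1,
"`B[I/b][b⁻¹] = B[b⁻¹]`"; Stacks 07Z3 (3)). [cite: MayeuxRicharzRomagny2020, §2.1] -/
theorem isLocalization_away :
    IsLocalization.Away (algebraMap O (dilatation ϖ I) ϖ)
      (Localization.Away (algebraMap O A ϖ)) := by
  rw [IsScalarTower.algebraMap_apply O A (dilatation ϖ I)]
  exact blowupAlgebra.isLocalization_away I _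

/-! ### The universal property (MRR §2.3; BLR 3.2/1) -/

variable {ϖ I} {C : Type w} [CommRing C]

/-- **The lift `A[I/ϖ] → C`** of a ring homomorphism `φ : A → C` with `φ(ϖ)` a non-zero-divisor
of `C` and `φ(I) ⊆ ϖC` (MRR §2.3, proof of the Proposition: "`g` extends (necessarily unique)
to a `B`-algebra morphism `B[I/b] → R`"; GW (13.19), p. 415).
[cite: MayeuxRicharzRomagny2020, §2.3 (Proposition, universal property)] -/
def lift (φ : A →+* C) (hreg : φ (algebraMap O A ϖ) ∈ nonZeroDivisors C)
    (hI : I.map φ ≤ Ideal.span {φ (algebraMap O A ϖ)}) : dilatation ϖ I →+* C :=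
  blowupAlgebra.lift I hreg hI

/-- The lift extends `φ`. [cite: MayeuxRicharzRomagny2020, §2.3] -/
@[simp]
theorem lift_algebraMap (φ : A →+* C) (hreg : φ (algebraMap O A ϖ) ∈ nonZeroDivisors C)
    (hI : I.map φ ≤ Ideal.span {φ (algebraMap O A ϖ)}) (x : A) :
    lift φ hreg hI (algebraMap A (dilatation ϖ I) x) = φ x :=
  blowupAlgebra.lift_algebraMap I hreg hI x

/-- The lift extends `φ` (composition form). [cite: MayeuxRicharzRomagny2020, §2.3] -/
theorem lift_comp_algebraMap (φ : A →+* C) (hreg : φ (algebraMap O A ϖ) ∈ nonZeroDivisors C)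
    (hI : I.map φ ≤ Ideal.span {φ (algebraMap O A ϖ)}) :
    (lift φ hreg hI).comp (algebraMap A (dilatation ϖ I)) = φ :=
  blowupAlgebra.lift_comp_algebraMap I hreg hI

/-- **`lift(y/ϖ) · φ(ϖ) = φ(y)`** for `y ∈ I`: the lift sends `y/ϖ` to the unique `c ∈ C` with
`φ(ϖ) c = φ(y)` (MRR §2.3: "there is a unique element `r ∈ R` such that `g(x) = bⁿ · r`. We
define `g̃([x/bⁿ]) := r`"). [cite: MayeuxRicharzRomagny2020, §2.3] -/
theorem lift_div_mul (φ : A →+* C) (hreg : φ (algebraMap O A ϖ) ∈ nonZeroDivisors C)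
    (hI : I.map φ ≤ Ideal.span {φ (algebraMap O A ϖ)}) {y : A} (hy : y ∈ I) :
    lift φ hreg hI ⟨_, div_mem ϖ I hy⟩ * φ (algebraMap O A ϖ) = φ y :=
  blowupAlgebra.lift_div_mul I hreg hI hy

/-- **Uniqueness** (MRR §2.3, injectivity: "since `B[b⁻¹] = B[I/b][b⁻¹]` we get
`g[b⁻¹] = g'[b⁻¹]`. As `b` is a non-zero divisor in `R` … this implies `g = g'`"): two ring
homomorphisms `A[I/ϖ] → C` agreeing on `A` are equal when `ϖ` is a non-zero-divisor of `C`.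
[cite: MayeuxRicharzRomagny2020, §2.3] -/
theorem ringHom_ext {φ : A →+* C} (hreg : φ (algebraMap O A ϖ) ∈ nonZeroDivisors C)
    {ψ₁ ψ₂ : dilatation ϖ I →+* C} (h₁ : ψ₁.comp (algebraMap A (dilatation ϖ I)) = φ)
    (h₂ : ψ₂.comp (algebraMap A (dilatation ϖ I)) = φ) : ψ₁ = ψ₂ :=
  blowupAlgebra.ringHom_ext I hreg h₁ h₂

/-- **The universal property of the dilatation, ring form** (MRR §2.3, Proposition; BLR
Prop. 3.2/1): for `φ : A → C` with `φ(ϖ)` a non-zero-divisor of `C`, the ring homomorphisms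
`A[I/ϖ] → C` extending `φ` form a singleton if `φ(I) ⊆ ϖ C` (and are otherwise absent, since
`I·A[I/ϖ] = ϖ·A[I/ϖ]`). [cite: MayeuxRicharzRomagny2020, §2.3 (Proposition, universal property)] -/
theorem existsUnique_lift (φ : A →+* C) (hreg : φ (algebraMap O A ϖ) ∈ nonZeroDivisors C)
    (hI : I.map φ ≤ Ideal.span {φ (algebraMap O A ϖ)}) :
    ∃! ψ : dilatation ϖ I →+* C, ψ.comp (algebraMap A (dilatation ϖ I)) = φ :=
  blowupAlgebra.existsUnique_lift I hreg hI

/-- The "otherwise absent" half: if some ring homomorphism `A[I/ϖ] → C` extends `φ`, then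
`φ(I) ⊆ φ(ϖ) C` (because `I·A[I/ϖ] = ϖ·A[I/ϖ]`), for `ϖ ∈ I`. [cite: MayeuxRicharzRomagny2020, §2.3] -/
theorem map_le_span_of_comp_eq (hϖ : algebraMap O A ϖ ∈ I) {φ : A →+* C}
    {ψ : dilatation ϖ I →+* C} (hψ : ψ.comp (algebraMap A (dilatation ϖ I)) = φ) :
    I.map φ ≤ Ideal.span {φ (algebraMap O A ϖ)} := by
  rw [← hψ, ← Ideal.map_map, map_eq_span ϖ I hϖ, Ideal.map_span, Set.image_singleton,
    IsScalarTower.algebraMap_apply O A (dilatation ϖ I)]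
  rfl

end dilatation

end General

/-! ### Over a domain: the universal property for flat algebras -/

section Domain

variable {O : Type u} [CommRing O] [IsDomain O] {ϖ : O} (hϖ : ϖ ≠ 0) {A : Type v} [CommRing A]
  [Algebra O A] {I : Ideal A} {C : Type w} [CommRing C] [Algebra O C]

namespace dilatation

include hϖ in
/-- In a flat algebra `C` over the domain `O`, the non-zero element `ϖ` is a non-zero-divisor.
[folklore] -/
theorem algebraMap_mem_nonZeroDivisors_of_flat [Module.Flat O C] :
    algebraMap O C ϖ ∈ nonZeroDivisors C := by
  have hreg : IsSMulRegular C ϖ :=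
    Module.Flat.isSMulRegular_of_nonZeroDivisors (mem_nonZeroDivisors_of_ne_zero hϖ)
  refine (mem_nonZeroDivisors_iff_right).mpr fun c hc => ?_
  apply hreg
  change ϖ • c = ϖ • (0 : C)
  rw [smul_zero, Algebra.smul_def, mul_comm]
  exact hc

include hϖ in
/-- **The universal property of the dilatation for flat algebras** (BLR Prop. 3.2/1 (b): for a
flat `R`-scheme `T`, the `X`-morphisms `T → X'` are the `X`-morphisms `T → X` whose special
fibre factors through `Y`; MRR §2.3 for `T ∈ Sch^D_X`, which contains every flat `T`): for a
flat `O`-algebra `C` and an `O`-algebra homomorphism `φ : A → C` with `φ(I) ⊆ ϖ C` there is a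
unique `O`-algebra homomorphism `A[I/ϖ] → C` extending `φ`. In particular (`C = O'` a discrete
valuation ring dominating `O`, e.g. `O` itself or its strict henselisation) the `O'`-valued
points of the dilatation are the `O'`-valued points of `Spec A` whose reduction lies in `V(I)`
(BLR 3.2/1; Artin, proof of (3.9) (f): "The points `(x', y')` with `x' ≡ 0 (mod p)` lift").
[cite: MayeuxRicharzRomagny2020, §2.3 (Proposition, universal property)]
[cite: Artin1986NeronModels, proof of Lemma (3.9), step (f) (p. 227)] -/
theorem existsUnique_algHom_of_flat [Module.Flat O C] (φ : A →ₐ[O] C)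
    (hI : I.map φ.toRingHom ≤ Ideal.span {algebraMap O C ϖ}) :
    ∃! ψ : dilatation ϖ I →ₐ[O] C, ψ.comp (IsScalarTower.toAlgHom O A (dilatation ϖ I)) = φ := by
  have hreg : φ.toRingHom (algebraMap O A ϖ) ∈ nonZeroDivisors C := by
    rw [AlgHom.toRingHom_eq_coe, RingHom.coe_coe, AlgHom.commutes]
    exact algebraMap_mem_nonZeroDivisors_of_flat hϖ
  have hI' : I.map φ.toRingHom ≤ Ideal.span {φ.toRingHom (algebraMap O A ϖ)} := by
    rwa [AlgHom.toRingHom_eq_coe, RingHom.coe_coe, AlgHom.commutes]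
  let ψ₀ : dilatation ϖ I →+* C := lift φ.toRingHom hreg hI'
  have hψ₀ : ∀ x : A, ψ₀ (algebraMap A (dilatation ϖ I) x) = φ x := fun x =>
    lift_algebraMap φ.toRingHom hreg hI' x
  let ψ : dilatation ϖ I →ₐ[O] C :=
    { ψ₀ with
      commutes' := fun o => by
        change ψ₀ (algebraMap O (dilatation ϖ I) o) = algebraMap O C o
        rw [IsScalarTower.algebraMap_apply O A (dilatation ϖ I), hψ₀, AlgHom.commutes] }
  refine ⟨ψ, AlgHom.ext fun x => hψ₀ x, fun ψ' hψ' => ?_⟩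
  apply AlgHom.coe_ringHom_injective
  refine ringHom_ext (φ := φ.toRingHom) hreg ?_ ?_
  · ext x
    exact AlgHom.congr_fun hψ' x
  · ext x
    exact hψ₀ x

end dilatation

end Domain

/-! ### Over a discrete valuation ring: flatness -/

section DVR

variable {O : Type u} [CommRing O] [IsDomain O] [IsDiscreteValuationRing O] {ϖ : O}
  (hϖ : Irreducible ϖ) {A : Type v} [CommRing A] [Algebra O A] (I : Ideal A)

namespace dilatation

include hϖ in
/-- Over a discrete valuation ring `O` with uniformizer `ϖ`, every non-zero element of `O`
becomes a unit in `A[1/ϖ]` (it is a unit times a power of `ϖ`). [folklore] -/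
theorem isUnit_algebraMap_away {o : O} (ho : o ≠ 0) :
    IsUnit (algebraMap O (Localization.Away (algebraMap O A ϖ)) o) := by
  obtain ⟨n, u, rfl⟩ := IsDiscreteValuationRing.eq_unit_mul_pow_irreducible ho hϖ
  rw [map_mul, map_pow]
  refine (u.isUnit.map _).mul (IsUnit.pow n ?_)
  rw [IsScalarTower.algebraMap_apply O A (Localization.Away (algebraMap O A ϖ))]
  exact IsLocalization.Away.algebraMap_isUnit (algebraMap O A ϖ)

include hϖ in
/-- `A[1/ϖ] = A ⊗_O K` is a torsion-free `O`-module, `O` a discrete valuation ring with uniformizer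
`ϖ` (no hypothesis on `A`). [folklore] -/
theorem isTorsionFree_away : Module.IsTorsionFree O (Localization.Away (algebraMap O A ϖ)) where
  isSMulRegular o ho x y hxy := by
    have ho0 : o ≠ 0 := by
      rintro rfl
      exact not_isRegular_zero ho
    have e : algebraMap O _ o * x = algebraMap O _ o * y := by
      simpa only [Algebra.smul_def] using hxy
    exact (isUnit_algebraMap_away hϖ ho0).mul_left_cancel e

include hϖ in
/-- **Dilatations are flat, I**: `A[I/ϖ]` is a torsion-free `O`-module (a submodule of the
torsion-free `A[1/ϖ]`), whatever `A` (BLR 3.2/1: the dilatation is a flat `R`-scheme; MRR §2.1: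
`b` is a non-zero-divisor of `B[I/b]`). [cite: MayeuxRicharzRomagny2020, §2.1] -/
theorem isTorsionFree : Module.IsTorsionFree O (dilatation ϖ I) :=
  haveI := isTorsionFree_away (A := A) hϖ
  Function.Injective.moduleIsTorsionFree (N := Localization.Away (algebraMap O A ϖ))
    (fun y : dilatation ϖ I => (y : Localization.Away (algebraMap O A ϖ))) Subtype.val_injective
    fun _ _ => rfl

include hϖ in
/-- **Dilatations are flat, II**: `A[I/ϖ]` is a flat `O`-algebra (torsion-free over the discrete
valuation ring `O`; BLR Prop. 3.2/1). [cite: MayeuxRicharzRomagny2020, §2.1] -/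
theorem flat : Module.Flat O (dilatation ϖ I) :=
  haveI := isTorsionFree hϖ I
  inferInstance

end dilatation

end DVR

end Literature.AlgebraicGeometry.Dilatations

end
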